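import Literature.AlgebraicGeometry.Motives.HodgeThetaSubalgebraGluedRealBlocks
import Literature.AlgebraicGeometry.HodgeTheory.MurtyTotallyRealMaximalSubfieldHodgeClasses
import Literature.AlgebraicGeometry.HodgeTheory.NoTypeIVTimesCMInvariance
import Literature.AlgebraicGeometry.HodgeTheory.NoTypeIVFactorProductsHodgeConjecture
import Literature.AlgebraicGeometry.HodgeTheory.HodgeEndomorphismsHOneOfRiemann
import Mathlib.NumberTheory.NumberField.InfinitePlace.TotallyRealComplex
import HarnessLib

/-!
# The Lie algebra of the Hodge group of a complex abelian variety whose endomorphism algebra contains a totally real self-commutant subfield of degree `dim A` is `⊕_{classes} 𝔰𝔩₂` glued along `End⁰(A) ⊗ ℂ` (V. K. Murty 1988 Thm. 2, `m = 1`; Hazama 1983 §3; Moonen–Zarhin 1999 (2.2) Type 2(1)) — the bridge to `Motives/HodgeThetaSubalgebraGluedRealBlocks`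

Family `hodge`, layer `Literature/AlgebraicGeometry/HodgeTheory`. Research context: cell `pub-hodge-ring2`
(HONEST FRAMING: research route conditional on HC_CM; not a corollary; Q11.4-sentence-2 already refuted in
dim ≥ 3), Literature lane, programme R6 (V. Kumar Murty 1988 Thm. 2 in the case `m = 1`, fact-free). This file
is the GEOMETRIC BRIDGE from a Murty packet `IsMurtyTypeWith A K φ 1` (`MurtyTotallyRealMaximalSubfieldHodgeClasses`:
`K` a totally real number field, `φ : K →+* End⁰(A)` self-commutant, `dim A = [K:ℚ]`) to the hypotheses of the
abstract theorem `HodgeStructure.GluedBlocks.exists_glued_adapted_blockBasis`; it generalises the programme-R2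
bridge `RealMultiplicationHodgeLieAlgebra` (`End⁰(A) = K`) to the case where `End⁰(A)` is LARGER than `K`
(type II minimal: `End⁰(A)` a totally indefinite quaternion algebra over a totally real field `F`, `K ⊃ F` a
maximal subfield; QM abelian surfaces, …). UNCONDITIONAL modulo the tree-light Betti hypotheses `hHD`, `hI`
(discharged by consumers with `exists_isReal_hodgeModel_holds`, `hodgePQ_independent_of_hodgeModel_holds`);
theorems and one definition of DATA (the joint eigenspaces); no named fact (D-0026); no step towards a summit
statement.

SETTING. `V = H¹(A(ℂ); ℚ)` with its weight-one Hodge structure `H = BettiUniverse.hodge _ _ 1`; `K` acts by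
`y ↦ (φ y)^*` (`ComplexMultiplication.hOneAlgHom φ`); for an embedding `κ : K → ℂ` the JOINT EIGENSPACE
`V_κ = {x ∈ V_ℂ | (φ y)^*_ℂ x = κ(y) x ∀ y}` (`jointEigenspace φ κ`).

MAIN RESULTS (all proved).
* §1 (input, tree theorem `hasNoTypeIVFactor_of_isMurtyTypeWith` of `NoTypeIVFactorProductsHodgeConjecture`): a
  Murty packet forces `HasNoTypeIVFactor A` (the centre of `End⁰(A)` commutes with `φ(K)`, hence lies in the
  totally real `φ(K)`), whence no `ψ`-skew central Hodge endomorphism of `H¹`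
  (`forall_central_skew_eq_zero_hodge_one_of_hasNoTypeIVFactor`, `NoTypeIVTimesCMInvariance`).
* §2 `isInternal_jointEigenspace` (`V_ℂ = ⊕_κ V_κ`), `finrank_jointEigenspace` (`dim V_κ = 2` when
  `dim A = [K:ℚ]`), `conj_mem_jointEigenspace` (`K` totally real ⟹ `V_κ` real),
  `mapsTo_jointEigenspace_of_forall_commute` (every rational operator commuting with `End_Hdg(H¹)` preserves the
  `V_κ`) — Hazama 1983 §3 «`H¹(A, ℂ) = V₁ ⊕ ⋯ ⊕ V_k`, `dim V_i = 2`»; Deligne LNM 900 §4.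
* §3 `exists_eq_smul_of_mem_span_endAlg_of_mapsTo` — the SELF-COMMUTANT hypothesis read on `H¹`: an element of
  `End_Hdg(H¹) ⊗ ℂ` preserving every `V_κ` is a scalar on each `V_κ` (commutant descent
  `mem_span_baseChange_of_forall_commute`, Riemann `mem_endAlg_hodge_one_iff_exists_bettiRep`, faithfulness of the
  rational representation).
* §4 THE THEOREM `exists_glued_adapted_blockBasis_of_isMurtyTypeWith_one`: for `IsMurtyTypeWith A K φ 1`, any
  polarization `ψ` of `H¹` and any Hodge operator `Θ`, there are a class map `cls` on the embeddings `K → ℂ` and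
  GLUED HODGE-ADAPTED bases `b'_κ = (b'_κ 0 ∈ H^{1,0}, b'_κ 1 ∈ H^{0,1})` of the `V_κ` such that for every
  bracket-closed rational `ψ`-skew `𝔤 ⊆ End_ℚ(H¹)` commuting with `End_Hdg(H¹)` with `Θ ∈ 𝔤_ℂ` — e.g. `Lie Hg(A)`
  (`hodgeLieC_eq_glued_sl2`: corollary §5) or the annihilator of a rational Hodge tensor — `𝔤_ℂ` is
  `⊕_{classes} 𝔰𝔩₂(ℂ)` acting diagonally on the blocks of each class: Hazama 1983 §3 (p. 306) «`𝔥 = 𝔰𝔩₂ × ⋯ × 𝔰𝔩₂`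
  where the i-th component acts on `V_i ⊕ ⋯ ⊕ V_i` diagonally»; Moonen–Zarhin 1999 (2.2) Type 2(1)
  «`Hg = U_{D^opp}`, `V_ℂ = W ⊗ ℂ²`»; Murty 1988 Thm. 2 (`Hod(A) = L(A)`, case `m = 1`, p. 66: «a special case of
  [Hazama, Thm. 4.1]»).

## References

* [Murty1988] V. Kumar Murty, *The Hodge group of an abelian variety*, Proc. AMS 104 (1988) 61–68 (held
  `paper:doi-10-1090-s0002-9939-1988-0958044-1`), Thm. 2 (p. 67), p. 66. [cite: Murty1988, Thm. 2 (p. 67)]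
* [Hazama1983] F. Hazama, Tôhoku Math. J. 35 (1983) 303–308 (held `paper:doi-10-2748-tmj-1178229056`), Thm. (1.1),
  Lemma (3.1), §3 pp. 305–306. [cite: Hazama1983, Thm. (1.1), Lemma (3.1) and §3 (pp. 305–306)]
* [MoonenZarhin1999LowDim] B. Moonen, Yu. Zarhin, Math. Ann. 315 (1999), §1, (2.2), §3 (3.1).
  [cite: MoonenZarhin1999LowDim, §1, (2.2) and §3 (3.1)]
* [Deligne1982HodgeCycles] P. Deligne, LNM 900 (1982), §4 p. 30; I §3 Prop. 3.4. [cite: Deligne1982HodgeCycles, §4 p. 30]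
* [DeligneMilne1982Tannakian] P. Deligne, J. S. Milne, LNM 900 (1982), §6 Thm. 6.20 (Riemann). [cite: DeligneMilne1982Tannakian, §6 Thm. 6.20]
* [Shimura1998] G. Shimura, *Abelian Varieties with Complex Multiplication and Modular Functions* (1998), §5.1.
  [cite: Shimura1998, §5.1]
-/

noncomputable section

open scoped TensorProduct
open CategoryTheory Module NumberField

namespace Literature.AlgebraicGeometry.HodgeTheory

open Literature.AlgebraicGeometry.Motives Literature.AlgebraicGeometry.ComplexMultiplication
open Literature.AlgebraicGeometry.Motives.HodgeStructure

section MurtyOne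

variable {A : AbelianVariety ℂ} {K : Type} [Field K] [NumberField K] (φ : K →+* A.endAlgebra)

/-! ### §1 A Murty packet forces «no factor of type IV» (tree input) -/

-- `hasNoTypeIVFactor_of_isMurtyTypeWith : IsMurtyTypeWith A K φ m → HasNoTypeIVFactor A` is the tree theorem of
-- `NoTypeIVFactorProductsHodgeConjecture`; combined with `forall_central_skew_eq_zero_hodge_one_of_hasNoTypeIVFactor`
-- it supplies the hypothesis `hE` (no `ψ`-skew central Hodge endomorphism) of the abstract glued-blocks theorem.

/-! ### §2 The joint eigenspaces `V_κ` of `K` on `H¹(A(ℂ); ℚ) ⊗ ℂ` -/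

/-- **The joint eigenspace `V_κ = {x ∈ H¹ ⊗ ℂ | (φ y)^*_ℂ x = κ(y) x ∀ y ∈ K}`** of the action of `K` through
`φ`, for an embedding `κ : K → ℂ` (Deligne LNM 900 §4: `H¹_B ⊗ ℂ = ⊕_σ H¹_{B,σ}`, «`e ∈ E` acts on `H¹_{B,σ}` as
`σ(e)`»; Hazama 1983 §3: `H¹(A, ℂ) = V₁ ⊕ ⋯ ⊕ V_k`). A definition of DATA. [cite: Deligne1982HodgeCycles, §4 p. 30]
[cite: Hazama1983, §3 (p. 305)] -/
def jointEigenspace (κ : K →+* ℂ) : Submodule ℂ (ℂ ⊗[ℚ] bettiCohomology A.X 1) :=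
  ⨅ y : K, Module.End.eigenspace ((hOneAlgHom φ y).baseChange ℂ) (κ y)

/-- Membership in `jointEigenspace`. [cite: Deligne1982HodgeCycles, §4 p. 30] -/
theorem mem_jointEigenspace_iff (κ : K →+* ℂ) (x : ℂ ⊗[ℚ] bettiCohomology A.X 1) :
    x ∈ jointEigenspace φ κ ↔ ∀ y : K, (hOneAlgHom φ y).baseChange ℂ x = κ y • x := by
  simp [jointEigenspace, Submodule.mem_iInf]

/-- **`H¹ ⊗ ℂ = ⊕_κ V_κ` is an internal direct sum** (independence through a primitive element of `K`,
spanning through the tree's `EndAction.iSup_eigenPiece_holds`; as `isInternal_eigenBlock_hodgeCharacter` of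
`RealMultiplicationHodgeLieAlgebra`, for `φ(K) ⊆ End⁰(A)` instead of `End⁰(A) = E`).
[cite: Deligne1982HodgeCycles, §4 p. 30] [cite: Hazama1983, §3 (p. 305)] -/
theorem isInternal_jointEigenspace (hHD : exists_isReal_hodgeModel) (hI : hodgePQ_independent_of_hodgeModel)
    [DecidableEq (K →+* ℂ)] : DirectSum.IsInternal (jointEigenspace (A := A) φ) := by
  set E := hOneEndAction φ hHD hI (A := A) with hE
  have hfun : jointEigenspace (A := A) φ =
      fun κ => ⨅ e : K, Module.End.eigenspace ((E.ι e).baseChange ℂ) (κ e) := rfl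
  rw [hfun]
  refine DirectSum.isInternal_submodule_of_iSupIndep_of_iSup_eq_top ?_ ?_
  · obtain ⟨α, hα⟩ := Field.exists_primitive_element ℚ K
    exact ((Module.End.eigenspaces_iSupIndep ((E.ι α).baseChange ℂ)).comp
      (EndAction.complexEmbedding_apply_injective_of_adjoin_eq_top hα)).mono fun κ =>
        iInf_le (fun e => Module.End.eigenspace ((E.ι e).baseChange ℂ) (κ e)) α
  · rw [eq_top_iff, ← iSup_piece_eq_top_holds
      (BettiUniverse.hodge hHD (AbelianVariety.isSmoothProjective_holds (A := A)) 1)]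
    refine iSup_le fun p => ?_
    rw [← EndAction.iSup_eigenPiece_holds E p _]
    refine iSup_mono fun κ => fun x hx => ?_
    exact (E.mem_iInf_eigenspace_iff κ x).2 ((E.mem_eigenPiece_iff κ p _ x).1 hx).2

/-- **Each `V_κ` is two-dimensional when `dim A = [K:ℚ]`**: `dim_ℂ V_κ · [K:ℚ] = dim_ℚ H¹ = 2 dim A`
(`EndAction.finrank_iInf_eigenspace_mul_finrank`, `finrank_bettiCohomology_one`). Hazama 1983 §3 «`dim V_i = 2`»;
Murty's «`V` free over `E` of rank `2m`», `m = 1`. [cite: Hazama1983, §3 (p. 306)] [cite: Murty1988, Thm. 2 (p. 67)] -/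
theorem finrank_jointEigenspace (hHD : exists_isReal_hodgeModel) (hI : hodgePQ_independent_of_hodgeModel)
    (hdim : A.dim = Module.finrank ℚ K) (κ : K →+* ℂ) : Module.finrank ℂ (jointEigenspace φ κ) = 2 := by
  haveI : FiniteDimensional ℚ (bettiCohomology A.X 1) := finite_bettiCohomology_one A
  have h : Module.finrank ℂ (jointEigenspace φ κ) * Module.finrank ℚ K =
      Module.finrank ℚ (bettiCohomology A.X 1) :=
    (hOneEndAction φ hHD hI (A := A)).finrank_iInf_eigenspace_mul_finrank κ
  rw [finrank_bettiCohomology_one, hdim] at h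
  exact Nat.eq_of_mul_eq_mul_right Module.finrank_pos h

/-- **For `K` totally real the `V_κ` are real** (`conj V_κ = V_κ`: the operators `(φ y)^*_ℂ` are real and the
eigenvalues `κ(y)` are real). [cite: Deligne1982HodgeCycles, §4 p. 30] [cite: Hazama1983, §3 (p. 305)] -/
theorem conj_mem_jointEigenspace [IsTotallyReal K] (κ : K →+* ℂ) {x : ℂ ⊗[ℚ] bettiCohomology A.X 1}
    (hx : x ∈ jointEigenspace φ κ) : HodgeStructure.conj x ∈ jointEigenspace φ κ := by
  rw [mem_jointEigenspace_iff] at hx ⊢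
  intro y
  have hreal : starRingEnd ℂ (κ y) = κ y := by
    have h := RingHom.congr_fun (ComplexEmbedding.isReal_iff.1 (IsTotallyReal.complexEmbedding_isReal κ)) y
    rwa [ComplexEmbedding.conjugate_coe_eq] at h
  rw [← conj_baseChange, hx y, conj_smul, hreal]

/-- `(φ y)^*` is a Hodge endomorphism of `H¹(A(ℂ); ℚ)`. [cite: Deligne1982HodgeCycles, §4 p. 30] -/
theorem hOneAlgHom_mem_endAlg (hHD : exists_isReal_hodgeModel) (hI : hodgePQ_independent_of_hodgeModel)
    (y : K) : hOneAlgHom φ y ∈ (BettiUniverse.hodge hHD (AbelianVariety.isSmoothProjective_holds (A := A)) 1).endAlg := by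
  rw [hOneAlgHom_apply]
  exact unop_bettiRep_mem_endAlg hHD hI (φ y)

/-- **Every rational operator commuting with `End_Hdg(H¹)` preserves the `V_κ`** (it commutes with the
`(φ y)^* ∈ End_Hdg(H¹)`). [cite: Deligne1982HodgeCycles, §4 p. 30] [cite: MoonenZarhin1999LowDim, §3 (3.1)] -/
theorem mapsTo_jointEigenspace_of_forall_commute (hHD : exists_isReal_hodgeModel)
    (hI : hodgePQ_independent_of_hodgeModel) {X : Module.End ℚ (bettiCohomology A.X 1)}
    (hX : ∀ a : (BettiUniverse.hodge hHD (AbelianVariety.isSmoothProjective_holds (A := A)) 1).endAlg,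
      X * (a : Module.End ℚ (bettiCohomology A.X 1)) = (a : Module.End ℚ (bettiCohomology A.X 1)) * X)
    (κ : K →+* ℂ) : Set.MapsTo (X.baseChange ℂ) (jointEigenspace φ κ) (jointEigenspace φ κ) := by
  intro x hx
  rw [SetLike.mem_coe, mem_jointEigenspace_iff] at hx ⊢
  intro y
  have hc : X * hOneAlgHom φ y = hOneAlgHom φ y * X := hX ⟨_, hOneAlgHom_mem_endAlg φ hHD hI y⟩
  rw [← Module.End.mul_apply, ← LinearMap.baseChange_mul, ← hc, LinearMap.baseChange_mul,
    Module.End.mul_apply, hx y, map_smul]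

/-- On `V_κ` the operator `(φ y)^*_ℂ` is the scalar `κ(y)`; hence an operator preserving every `V_κ` commutes
with the `(φ y)^*_ℂ`. [cite: Deligne1982HodgeCycles, §4 p. 30] -/
theorem commute_hOneAlgHom_baseChange_of_mapsTo (hHD : exists_isReal_hodgeModel)
    (hI : hodgePQ_independent_of_hodgeModel) [DecidableEq (K →+* ℂ)]
    {u : Module.End ℂ (ℂ ⊗[ℚ] bettiCohomology A.X 1)}
    (huT : ∀ κ, Set.MapsTo u (jointEigenspace φ κ) (jointEigenspace φ κ)) (y : K) :
    u * (hOneAlgHom φ y).baseChange ℂ = (hOneAlgHom φ y).baseChange ℂ * u := by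
  refine LinearMap.ext fun x => ?_
  have hx : x ∈ ⨆ κ, jointEigenspace (A := A) φ κ := by
    rw [(isInternal_jointEigenspace φ hHD hI).submodule_iSup_eq_top]; exact Submodule.mem_top
  induction hx using Submodule.iSup_induction' with
  | mem κ x hx =>
    rw [Module.End.mul_apply, Module.End.mul_apply, (mem_jointEigenspace_iff φ κ x).1 hx y, map_smul,
      (mem_jointEigenspace_iff φ κ (u x)).1 (huT κ hx) y]
  | zero => simp
  | add x x' _ _ hx hx' => rw [map_add, map_add, hx, hx']

/-! ### §3 The self-commutant hypothesis read on `H¹`: elements of `End_Hdg(H¹) ⊗ ℂ` preserving the `V_κ` are scalars on them -/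

/-- **An element of `End_Hdg(H¹) ⊗ ℂ` preserving every `V_κ` is a scalar on each `V_κ`**, when `φ(K)` is its own
commutant in `End⁰(A)` (Murty's «maximal commutative subalgebra»). Proof: `u` commutes with `Lie Hdg ⊗ 1` (as
every element of `End_Hdg ⊗ ℂ` does) and with the `(φ y)^* ⊗ 1` (it preserves their joint eigenspaces, which
span), hence — commutant descent `mem_span_baseChange_of_forall_commute` — lies in the `ℂ`-span of the RATIONAL
`b` commuting with both; such a `b` is a Hodge endomorphism (`ThetaSubalgebra.mem_endAlg_of_forall_commute`),
i.e. `b = z^*` with `z ∈ End⁰(A)` (Riemann, `mem_endAlg_hodge_one_iff_exists_bettiRep`) commuting with `φ(K)`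
(faithfulness `bettiRep_injective`), so `z = φ(y₀)` and `b_ℂ = κ(y₀)` on `V_κ`.
[cite: Murty1988, Thm. 2 and §2 (p. 62)] [cite: DeligneMilne1982Tannakian, §6 Thm. 6.20]
[cite: Deligne1982HodgeCycles, I §3 Prop. 3.4] -/
theorem exists_eq_smul_of_mem_span_endAlg_of_mapsTo [HodgeTensorFacts.{0, 0}] (hHD : exists_isReal_hodgeModel)
    (hI : hodgePQ_independent_of_hodgeModel) [DecidableEq (K →+* ℂ)]
    (hself : ∀ x : A.endAlgebra, (∀ y : K, Commute x (φ y)) → x ∈ Set.range φ)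
    {u : Module.End ℂ (ℂ ⊗[ℚ] bettiCohomology A.X 1)}
    (hu : u ∈ Submodule.span ℂ ((fun a : Module.End ℚ (bettiCohomology A.X 1) => a.baseChange ℂ) ''
      ((BettiUniverse.hodge hHD (AbelianVariety.isSmoothProjective_holds (A := A)) 1).endAlg :
        Set (Module.End ℚ (bettiCohomology A.X 1)))))
    (huT : ∀ κ, Set.MapsTo u (jointEigenspace φ κ) (jointEigenspace φ κ)) (κ : K →+* ℂ) :
    ∃ c : ℂ, ∀ x ∈ jointEigenspace φ κ, u x = c • x := by
  haveI : Module.Finite ℚ (bettiCohomology A.X 1) := finite_bettiCohomology_one A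
  set H := BettiUniverse.hodge hHD (AbelianVariety.isSmoothProjective_holds (A := A)) 1 with hH
  obtain ⟨Θ, hΘ⟩ := exists_hodgeTheta H
  have hΘC : Θ ∈ spanC H.hodgeLie := H.mem_hodgeLieC_of_forall_piece hΘ
  -- `u` commutes with `Lie Hdg ⊗ 1`
  have hu1 : ∀ X ∈ H.hodgeLie, u * X.baseChange ℂ = X.baseChange ℂ * u := fun X hX =>
    (GluedBlocks.baseChange_comm_of_mem_span_endAlg H (fun a => H.commute_of_mem_hodgeLie hX a) hu).symm
  -- and with the `(φ y)^* ⊗ 1`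
  have hu2 : ∀ y : K, u * (hOneAlgHom φ y).baseChange ℂ = (hOneAlgHom φ y).baseChange ℂ * u :=
    commute_hOneAlgHom_baseChange_of_mapsTo φ hHD hI huT
  -- commutant descent
  set 𝔥 : Set (Module.End ℚ (bettiCohomology A.X 1)) :=
    (H.hodgeLie : Set (Module.End ℚ (bettiCohomology A.X 1))) ∪ Set.range (hOneAlgHom φ) with h𝔥
  have h𝔥u : ∀ X ∈ 𝔥, u * X.baseChange ℂ = X.baseChange ℂ * u := by
    rintro X (hX | ⟨y, rfl⟩)
    · exact hu1 X hX
    · exact hu2 y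
  have hdesc := mem_span_baseChange_of_forall_commute 𝔥 h𝔥u
  -- the rational operators commuting with `𝔥` are the `(φ y₀)^*`
  have hrat : ∀ b : Module.End ℚ (bettiCohomology A.X 1), (∀ X ∈ 𝔥, b * X = X * b) →
      ∃ y₀ : K, b = hOneAlgHom φ y₀ := by
    intro b hb
    have hbE : b ∈ H.endAlg :=
      ThetaSubalgebra.mem_endAlg_of_forall_commute H H.hodgeLie hΘ hΘC fun X hX => hb X (Or.inl hX)
    obtain ⟨z, hz⟩ := (mem_endAlg_hodge_one_iff_exists_bettiRep hHD hI b).1 hbE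
    have hcomm : ∀ y : K, Commute z (φ y) := by
      intro y
      have h1 := hb (hOneAlgHom φ y) (Or.inr ⟨y, rfl⟩)
      rw [← hz, hOneAlgHom_apply, ← MulOpposite.unop_mul, ← MulOpposite.unop_mul, ← map_mul, ← map_mul] at h1
      exact (bettiRep_injective (MulOpposite.unop_injective h1)).symm
    obtain ⟨y₀, hy₀⟩ := hself z hcomm
    refine ⟨y₀, ?_⟩
    rw [← hz, hOneAlgHom_apply, hy₀]
  -- conclusion by span induction: being a scalar on `V_κ` is a linear condition
  clear h𝔥u hu2 hu1 huT hu
  induction hdesc using Submodule.span_induction with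
  | mem Z hZ =>
    obtain ⟨b, hb, rfl⟩ := hZ
    obtain ⟨y₀, rfl⟩ := hrat b hb
    exact ⟨κ y₀, fun x hx => (mem_jointEigenspace_iff φ κ x).1 hx y₀⟩
  | zero => exact ⟨0, fun x _ => by rw [LinearMap.zero_apply, zero_smul]⟩
  | add Z Z' _ _ hZ hZ' =>
    obtain ⟨c, hc⟩ := hZ
    obtain ⟨c', hc'⟩ := hZ'
    exact ⟨c + c', fun x hx => by rw [LinearMap.add_apply, hc x hx, hc' x hx, add_smul]⟩
  | smul a Z _ hZ =>
    obtain ⟨c, hc⟩ := hZ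
    exact ⟨a * c, fun x hx => by rw [LinearMap.smul_apply, hc x hx, smul_smul]⟩

/-! ### §4 The theorem: glued Hodge-adapted bases of the `V_κ`; `𝔤_ℂ = ⊕_{classes} 𝔰𝔩₂` for every admissible `𝔤` -/

/-- **Theorem (V. K. Murty 1988 Thm. 2 for `m = 1`, Lie-algebra form; Hazama 1983 §3; Moonen–Zarhin 1999 (2.2)
Type 2(1)).** Let `A` be a complex abelian variety with a Murty packet `(K, φ, 1)`: `K` a totally real number
field, `φ : K →+* End⁰(A)` its own commutant, `dim A = [K:ℚ]`. Let `ψ` be ANY polarization of the weight-one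
Hodge structure `H¹(A(ℂ); ℚ)` and `Θ` a Hodge operator (`2p - 1` on `H^{p,1-p}`). Then there are a class map
`cls` on the embeddings `κ : K → ℂ` (`cls ∘ cls = cls`) and bases `b'_κ = (b'_κ 0, b'_κ 1)` of the joint
eigenspaces `V_κ` (`H¹ ⊗ ℂ = ⊕_κ V_κ`, `dim V_κ = 2`) ADAPTED to the Hodge decomposition (`b'_κ 0 ∈ H^{1,0}`,
`b'_κ 1 ∈ H^{0,1}`) such that for EVERY bracket-closed rational subspace `𝔤 ⊆ End_ℚ(H¹)` of `ψ`-skew operators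
commuting with `End_Hdg(H¹)` and with `Θ ∈ 𝔤_ℂ` (the Lie algebra of the Hodge group; the annihilator of a
rational Hodge tensor): (1) every `Y ∈ 𝔤_ℂ` has trace-free blocks; (2) the blocks of `Y ∈ 𝔤_ℂ` at `κ`, `κ'`
with `cls κ = cls κ'` COINCIDE (in the bases `b'`); (3) for every `κ₀` and every trace-free `N ∈ M₂(ℂ)` the
operator equal to `N` on the `V_κ` with `cls κ = cls κ₀` and to `0` on the others lies in `𝔤_ℂ` — i.e.
`𝔤_ℂ = ⊕_{classes} 𝔰𝔩₂(ℂ)`, «the i-th component `𝔰𝔩₂` acts on `V_i ⊕ ⋯ ⊕ V_i` diagonally» (Hazama p. 306),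
«Type 2(1): `Hg = U_{D^opp}`, `V_ℂ = W ⊗ ℂ²`» (Moonen–Zarhin (2.2)), `Hod(A) = L(A)` (Murty Thm. 2). The abstract
theorem `HodgeStructure.GluedBlocks.exists_glued_adapted_blockBasis` fed with §1–§3 and with
`forall_central_skew_eq_zero_hodge_one_of_hasNoTypeIVFactor`. [cite: Murty1988, Thm. 2 (p. 67)]
[cite: Hazama1983, Thm. (1.1), Lemma (3.1) and §3 (pp. 305–306)] [cite: MoonenZarhin1999LowDim, (2.2) and §3 (3.1)] -/
theorem exists_glued_adapted_blockBasis_of_isMurtyTypeWith_one [HodgeTensorFacts.{0, 0}]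
    [DecidableEq (K →+* ℂ)] (hA : IsMurtyTypeWith A K φ 1) (hHD : exists_isReal_hodgeModel)
    (hI : hodgePQ_independent_of_hodgeModel)
    (ψ : (BettiUniverse.hodge hHD (AbelianVariety.isSmoothProjective_holds (A := A)) 1).Polarization)
    {Θ : Module.End ℂ (ℂ ⊗[ℚ] bettiCohomology A.X 1)}
    (hΘ : ∀ p, ∀ x ∈ (BettiUniverse.hodge hHD (AbelianVariety.isSmoothProjective_holds (A := A)) 1).piece p
      (((1 : ℕ) : ℤ) - p), Θ x = ((2 * p - ((1 : ℕ) : ℤ) : ℤ) : ℂ) • x) :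
    ∃ (cls : (K →+* ℂ) → (K →+* ℂ)) (b' : ∀ κ : K →+* ℂ, Module.Basis (Fin 2) ℂ (jointEigenspace φ κ)),
      (∀ κ, (b' κ 0 : ℂ ⊗[ℚ] bettiCohomology A.X 1) ∈
        (BettiUniverse.hodge hHD (AbelianVariety.isSmoothProjective_holds (A := A)) 1).piece 1 0) ∧
      (∀ κ, (b' κ 1 : ℂ ⊗[ℚ] bettiCohomology A.X 1) ∈
        (BettiUniverse.hodge hHD (AbelianVariety.isSmoothProjective_holds (A := A)) 1).piece 0 1) ∧
      (∀ κ, cls (cls κ) = cls κ) ∧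
      ∀ 𝔤 : Submodule ℚ (Module.End ℚ (bettiCohomology A.X 1)),
        (∀ X ∈ 𝔤, ∀ Y ∈ 𝔤, X * Y - Y * X ∈ 𝔤) → Θ ∈ spanC 𝔤 →
        (∀ X ∈ 𝔤, ∀ a : (BettiUniverse.hodge hHD (AbelianVariety.isSmoothProjective_holds (A := A)) 1).endAlg,
          X * (a : Module.End ℚ (bettiCohomology A.X 1)) = (a : Module.End ℚ (bettiCohomology A.X 1)) * X) →
        (∀ X ∈ 𝔤, ∀ v w, ψ.form (X v) w + ψ.form v (X w) = 0) →
        (∀ Y ∈ spanC 𝔤, ∀ κ, (RealPlaces.blockMat (isInternal_jointEigenspace φ hHD hI) b' Y κ).trace = 0) ∧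
        (∀ Y ∈ spanC 𝔤, ∀ κ κ', cls κ = cls κ' →
          RealPlaces.blockMat (isInternal_jointEigenspace φ hHD hI) b' Y κ =
            RealPlaces.blockMat (isInternal_jointEigenspace φ hHD hI) b' Y κ') ∧
        (∀ (κ₀ : K →+* ℂ) (N : Matrix (Fin 2) (Fin 2) ℂ), N.trace = 0 →
          RealPlaces.assemble (isInternal_jointEigenspace φ hHD hI) b'
            (fun κ => if cls κ = cls κ₀ then N else 0) ∈ spanC 𝔤) := by
  haveI : Module.Finite ℚ (bettiCohomology A.X 1) := finite_bettiCohomology_one A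
  have hX : IsSmoothProjective A.dim A.X := AbelianVariety.isSmoothProjective_holds
  haveI : IsTotallyReal K := hA.1
  have hdim : A.dim = Module.finrank ℚ K := by rw [hA.2.2.1, mul_one]
  obtain ⟨cls, b', hb0, hb1, hidem, hall⟩ := GluedBlocks.exists_glued_adapted_blockBasis
    (BettiUniverse.hodge hHD (AbelianVariety.isSmoothProjective_holds (A := A)) 1) Nat.cast_one
    (BettiUniverse.hodge_isEffective hHD hX 1) ψ (isInternal_jointEigenspace φ hHD hI)
    (fun κ x hx => conj_mem_jointEigenspace φ κ hx) (finrank_jointEigenspace φ hHD hI hdim)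
    (fun X hXc κ => mapsTo_jointEigenspace_of_forall_commute φ hHD hI hXc κ)
    (fun u hu huT κ => exists_eq_smul_of_mem_span_endAlg_of_mapsTo φ hHD hI hA.2.1 hu huT κ)
    (forall_central_skew_eq_zero_hodge_one_of_hasNoTypeIVFactor (hasNoTypeIVFactor_of_isMurtyTypeWith hA)
      hHD hI ψ) hΘ
  refine ⟨cls, b', fun κ => ?_, fun κ => ?_, hidem, hall⟩
  · have h := hb0 κ
    have e : (((1 : ℕ) : ℤ) - 1) = 0 := by norm_num
    rwa [e] at h
  · have h := hb1 κ
    have e : (((1 : ℕ) : ℤ) - 0) = 1 := by norm_num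
    rwa [e] at h

/-! ### §5 The Lie algebra of the Hodge group: `Lie Hg(A) ⊗ ℂ = ⊕_{classes} 𝔰𝔩₂(ℂ)`, glued -/

/-- A family constant on the classes is the sum over the classes of its class-indicator pieces. [folklore] -/
private theorem eq_sum_classIndicator {ι : Type*} [Fintype ι] [DecidableEq ι] {M : Type*} [AddCommMonoid M]
    (cls : ι → ι) (f : ι → M) (hf : ∀ k, f k = f (cls k)) :
    f = ∑ γ ∈ Finset.univ.image cls, fun k => if cls k = γ then f γ else 0 := by
  funext k
  rw [Finset.sum_apply, Finset.sum_eq_single (cls k)]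
  · rw [if_pos rfl, ← hf]
  · intro γ _ hγ
    rw [if_neg (Ne.symm hγ)]
  · intro h
    exact absurd (Finset.mem_image_of_mem cls (Finset.mem_univ k)) h

/-- **Theorem (the Lie algebra of the Hodge group of `A`; Murty 1988 Thm. 2 `Hod(A) = L(A)` for `m = 1`, Hazama
1983 §3, Moonen–Zarhin 1999 (2.2) Type 2(1)).** For `A` with a Murty packet `(K, φ, 1)` there are a class map
`cls` and glued Hodge-adapted bases `b'_κ` of the `V_κ` in which a `ℂ`-linear endomorphism `Y` of `H¹ ⊗ ℂ` lies
in `Lie Hg(A) ⊗ ℂ` IF AND ONLY IF it preserves every `V_κ`, has trace-free blocks, and has EQUAL blocks at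
`κ, κ'` whenever `cls κ = cls κ'`: `Lie Hg(A) ⊗ ℂ = ⊕_{classes} 𝔰𝔩₂(ℂ)` acting diagonally on the blocks of each
class (for `End⁰(A) = K` all classes are singletons and this is the tree's
`mem_hodgeLieC_hodge_one_iff_mapsTo_of_isTotallyReal`, `⊕_κ 𝔰𝔩(V_κ)`; for `End⁰(A)` a quaternion algebra
over `F` with maximal subfield `K` the classes are the fibres of `κ ↦ κ|_F`).
[cite: Murty1988, Thm. 2 (p. 67)] [cite: Hazama1983, Thm. (1.1) and §3 (pp. 305–306)]
[cite: MoonenZarhin1999LowDim, (2.2) and §3 (3.1)] -/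
theorem exists_mem_hodgeLieC_iff_of_isMurtyTypeWith_one [HodgeTensorFacts.{0, 0}] [DecidableEq (K →+* ℂ)]
    [Module.Finite ℚ (bettiCohomology A.X 1)] (hA : IsMurtyTypeWith A K φ 1) (hHD : exists_isReal_hodgeModel)
    (hI : hodgePQ_independent_of_hodgeModel) :
    ∃ (cls : (K →+* ℂ) → (K →+* ℂ)) (b' : ∀ κ : K →+* ℂ, Module.Basis (Fin 2) ℂ (jointEigenspace φ κ)),
      (∀ κ, (b' κ 0 : ℂ ⊗[ℚ] bettiCohomology A.X 1) ∈
        (BettiUniverse.hodge hHD (AbelianVariety.isSmoothProjective_holds (A := A)) 1).piece 1 0) ∧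
      (∀ κ, (b' κ 1 : ℂ ⊗[ℚ] bettiCohomology A.X 1) ∈
        (BettiUniverse.hodge hHD (AbelianVariety.isSmoothProjective_holds (A := A)) 1).piece 0 1) ∧
      (∀ κ, cls (cls κ) = cls κ) ∧
      ∀ Y : Module.End ℂ (ℂ ⊗[ℚ] bettiCohomology A.X 1),
        Y ∈ (BettiUniverse.hodge hHD (AbelianVariety.isSmoothProjective_holds (A := A)) 1).hodgeLieC ↔
          (∀ κ, Set.MapsTo Y (jointEigenspace φ κ) (jointEigenspace φ κ)) ∧
          (∀ κ, (RealPlaces.blockMat (isInternal_jointEigenspace φ hHD hI) b' Y κ).trace = 0) ∧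
          (∀ κ κ', cls κ = cls κ' → RealPlaces.blockMat (isInternal_jointEigenspace φ hHD hI) b' Y κ =
            RealPlaces.blockMat (isInternal_jointEigenspace φ hHD hI) b' Y κ') := by
  have hX : IsSmoothProjective A.dim A.X := AbelianVariety.isSmoothProjective_holds
  set H := BettiUniverse.hodge hHD (AbelianVariety.isSmoothProjective_holds (A := A)) 1 with hH
  -- a polarization and a Hodge operator
  obtain ⟨ψ⟩ : H.IsPolarizable :=
    smoothProjective_hodgeStructure_isPolarizable_holds hX (BettiUniverse.realHodgeModel hHD hX)
      (BettiUniverse.realHodgeModel_isHodgeSymmetric hHD hX) 1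
  obtain ⟨Θ, hΘ⟩ := exists_hodgeTheta H
  obtain ⟨cls, b', hb0, hb1, hidem, hall⟩ :=
    exists_glued_adapted_blockBasis_of_isMurtyTypeWith_one φ hA hHD hI ψ hΘ
  -- `Lie Hg` is admissible
  have hΘC : Θ ∈ spanC H.hodgeLie := H.mem_hodgeLieC_of_forall_piece hΘ
  obtain ⟨h1, h2, h3⟩ := hall H.hodgeLie (fun X hX Y hY => H.commutator_mem_hodgeLie hX hY) hΘC
    (fun X hX a => H.commute_of_mem_hodgeLie hX a) (fun X hX v w => form_apply_add_eq_zero_of_mem_hodgeLie ψ hX v w)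
  have hT : ∀ X ∈ H.hodgeLie, ∀ κ, Set.MapsTo (X.baseChange ℂ) (jointEigenspace φ κ) (jointEigenspace φ κ) :=
    fun X hX κ => mapsTo_jointEigenspace_of_forall_commute φ hHD hI (fun a => H.commute_of_mem_hodgeLie hX a) κ
  refine ⟨cls, b', hb0, hb1, hidem, fun Y => ⟨fun hY => ?_, fun hY => ?_⟩⟩
  · have hY' : Y ∈ spanC H.hodgeLie := hY
    exact ⟨fun κ => mapsTo_of_mem_spanC (T := jointEigenspace φ κ) (fun X hX => hT X hX κ) hY', h1 Y hY',
      h2 Y hY'⟩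
  · obtain ⟨hYT, htr, hcls⟩ := hY
    -- `Y = assemble (blockMat Y)`, and `blockMat Y` is constant on the classes
    have hconst : ∀ κ, RealPlaces.blockMat (isInternal_jointEigenspace φ hHD hI) b' Y κ =
        RealPlaces.blockMat (isInternal_jointEigenspace φ hHD hI) b' Y (cls κ) :=
      fun κ => hcls κ (cls κ) (by rw [hidem])
    rw [show Y = RealPlaces.assemble (isInternal_jointEigenspace φ hHD hI) b'
        (RealPlaces.blockMat (isInternal_jointEigenspace φ hHD hI) b' Y) from
      (RealPlaces.assemble_blockMat _ b' hYT).symm,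
      eq_sum_classIndicator cls _ hconst, map_sum]
    refine Submodule.sum_mem _ fun γ hγ => ?_
    obtain ⟨κ₀, -, rfl⟩ := Finset.mem_image.1 hγ
    have h := h3 (cls κ₀) (RealPlaces.blockMat (isInternal_jointEigenspace φ hHD hI) b' Y (cls κ₀)) (htr _)
    simp only [hidem] at h
    exact h

end MurtyOne

end Literature.AlgebraicGeometry.HodgeTheory

end
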